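/-
Copyright (c) 2026. All rights reserved.
Released under Apache 2.0 license as described in the file LICENSE.
Authors: abc-iut cell — abc-iut-w4-d064 (corollary booked by ruling α10-4; the `IsProfiniteCompletion` machinery is abc-iut-L3-t7's `ChartFibreProfiniteCompletion.lean`, the residual finiteness is `TemperedResiduallyFiniteHolds.lean`).
-/
import Literature.AnabelianGeometry.SemiGraphs.TemperedResiduallyFiniteHolds
import Literature.AnabelianGeometry.SemiGraphs.ChartFibreProfiniteCompletion
import HarnessLib

/-!
# [SemiAnbd] Prop. 3.6 (iii) AS PRINTED: `π₁^temp(𝒢) ↪ π̂₁(𝒢)` is injective — unconditional under `Prop36Hypotheses`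

Mochizuki, *Semi-graphs of anabelioids*, Publ. RIMS **42** (2006), §3 Prop. 3.6 (iii) p. 38: "The full
embedding `B(G) ↪ B^temp(G)` induces an injection `π₁^temp(G) ↪ π̂₁(G)` of topological groups."
PROOF-ONLY corollary (0 defs): `ChartFibreProfiniteCompletion.lean` proves that the chart action
`chartActionFin : π₁^temp(𝒢) → Aut Φ` on the finite fibre functor `Φ` is the profinite-completion map
(`isProfiniteCompletion_chartActionFin_of_prop36`) and is injective GIVEN the named fact
`TemperedPiResiduallyFinite` (`injective_chartActionFin_of_residuallyFinite`); that named fact is now the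
theorem `TemperedPiResiduallyFinite_holds` (`TemperedResiduallyFiniteHolds.lean`), so the injectivity —
the printed form of Prop. 3.6 (iii) — holds outright for every `𝒢` satisfying `Prop36Hypotheses` and
every chart.  Nothing here takes a side on [IUTchIII] Cor. 3.12.
-/

namespace Literature.AnabelianGeometry.SemiGraphs

namespace ProfiniteSemiGraph

open CategoryTheory CategoryTheory.Limits CategoryTheory.PreGaloisCategory
open Literature.AnabelianGeometry.Anabelioids

universe u

variable {𝒢 : ProfiniteSemiGraph.{u}}

/-- **[SemiAnbd] Prop. 3.6 (iii) as printed** — "induces an injection `π₁^temp(G) ↪ π̂₁(G)`": for every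
`𝒢` satisfying the hypotheses of Prop. 3.6 and every chart `c` of `π₁^temp(𝒢)`, the profinite-completion
map `chartActionFin : π₁^temp(𝒢) → Aut Φ` is injective (unconditional: `TemperedPiResiduallyFinite_holds`).
[cite: MochizukiSemiAnbd2006, Prop 3.6(iii) p.38] -/
theorem injective_chartActionFin_of_prop36 (h36 : 𝒢.Prop36Hypotheses) (c : TemperedPiChart 𝒢)
    (hfin : ∀ X : 𝒢.toAnab.BObj,
      Finite ((chartFibre c (isTempered_of_isFinite_of_prop36 h36)).obj X)) :
    Function.Injective (chartActionFin c (isTempered_of_isFinite_of_prop36 h36) hfin) :=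
  injective_chartActionFin_of_residuallyFinite TemperedPiResiduallyFinite_holds h36 c hfin

/-- **[SemiAnbd] Prop. 3.6 (iii), full package under `Prop36Hypotheses`**: for every chart `c` of
`π₁^temp(𝒢)` the chart basepoint `Φ` is a fibre functor of `B(𝒢)` (so `Aut Φ` models `π̂₁(𝒢)`),
`chartActionFin : π₁^temp(𝒢) → Aut Φ` is the profinite-completion map, AND it is injective — i.e.
"`π₁^temp(G) ↪ π̂₁(G)`" as printed (extends `exists_isProfiniteCompletion_chart` by the injectivity).
[cite: MochizukiSemiAnbd2006, Prop 3.6(iii) p.38] -/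
theorem exists_isProfiniteCompletion_injective_chart (h36 : 𝒢.Prop36Hypotheses)
    (c : TemperedPiChart 𝒢) :
    letI := 𝒢.toAnab.preGaloisCategory_bObj
    ∃ hfin : ∀ X : 𝒢.toAnab.BObj,
        Finite ((chartFibre c (isTempered_of_isFinite_of_prop36 h36)).obj X),
      Nonempty (FiberFunctor (chartFibreFin c (isTempered_of_isFinite_of_prop36 h36) hfin)) ∧
      IsProfiniteCompletion
        ({ toMonoidHom := chartActionFin c (isTempered_of_isFinite_of_prop36 h36) hfin,
           continuous_toFun :=
             continuous_chartActionFin c (isTempered_of_isFinite_of_prop36 h36) hfin } :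
          c.G →ₜ* Aut (chartFibreFin c (isTempered_of_isFinite_of_prop36 h36) hfin)) ∧
      Function.Injective (chartActionFin c (isTempered_of_isFinite_of_prop36 h36) hfin) := by
  letI := 𝒢.toAnab.preGaloisCategory_bObj
  obtain ⟨hfin, hΦ, hPC⟩ := exists_isProfiniteCompletion_chart h36 c
  exact ⟨hfin, hΦ, hPC, injective_chartActionFin_of_prop36 h36 c hfin⟩

end ProfiniteSemiGraph

end Literature.AnabelianGeometry.SemiGraphs
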